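import Summits.MatrixMultiplication.OmegaCensus.STPPSmallPatternKernelReflect

/-!
# ω-census, small STPP pattern `(2,1,1)^k`: kernel search — TWO-LEVEL chunking (engine variant + reflection)

HONEST FRAMING (pub-omega census; verbatim): lottery ticket; floor = certified bounds/negative ranges.
Census STRUCTURE bookkeeping of the STPP track (seat pub-omega-eng2 = ENG2, gen 33, on the engine + reflection of seat
pub-omega-stpp-3 gen 23; STRUCTURE row B5, the threshold column `T1(H) = max {k : (2,1,1)^k ⊆ H}` — its LOWER sides as
kernel theorems), not progress on `ω`: small patterns in small groups bound no exponent.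

The kernel mask search `STPP211Neg.search` (`STPPSmallPatternKernelSearch.lean`) splits its work by chunks `(d, x1)`:
representative `d` of `A₀ = {0, d}` and an exclusion mask `x1` for the FIRST-level `c₁`.  From `k = 6` on (orders `26 … 29`)
single first-level subtrees exceed one affordable `decide +kernel` (up to `5·10⁶` mask translations ≈ 250 s at the farm's
46 µs per translation), so this file adds the variant with a SECOND-level exclusion mask:

* `belowX2 g r x1 x2` — below the start state: first level `c ∉ x1`, second level `c ∉ x2`, free below (`belowX g · x2` is
  exactly "one restricted level, then free");  `search2 g k chunks` over chunks `(d, x1, x2)`; `search2_cons/_append`.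
* REFLECTION, verbatim along `STPPSmallPatternKernelReflect.lean` §7–§9 with one more restricted level: `start_false2`,
  `not_modelNF_of_search2`, `not_modelD_of_search2`, and the theorem the per-group files use,
  `not_exists_isSTPP_211_of_search2` — **if `search2 E.g K chunks = true`, the chunks of every listed representative cover
  every PAIR of codes `(y₁, y₂)` (some chunk of `d` has bit `y₁` of `x1` and bit `y₂` of `x2` clear), and every nonzero `d` is
  carried into the representative list by an injective additive map of `auts`, then `G` admits no STPP family (CKSU Def. 5.1,
  tree `IsSTPP`) of `K` triples with `|Aᵢ| = 2`, `|Bᵢ| = |Cᵢ| = 1`.**  A first-level-only chunk is `(d, x1, 0)`.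

References: H. Cohn, R. Kleinberg, B. Szegedy, C. Umans, *Group-theoretic algorithms for matrix multiplication*, FOCS 2005
(arXiv:math/0511460), Def. 5.1.  Record: pub-omega HOME `pub-omega-eng2-g33/results/none6/` (C mirror `k211c.c` with
per-`(d,c₁,c₂)` cost tables, planner `plan6.py`).
-/

open Literature.Computability.AlgebraicComplexity

namespace Summit.MatrixMultiplication.OmegaCensus

namespace STPP211Neg

/-! ## 1. The two-level-chunked search -/

/-- The search below the start state, `r` triples to place: the FIRST level restricted to `c ∉ x1`, the SECOND to
`c ∉ x2`, no restriction below. -/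
noncomputable def belowX2 (g : GC) (r x1 x2 : ℕ) : St → Bool :=
  @Nat.rec (fun _ => St → Bool) (fun _ => false) (fun r' _ S => level g S r' x1 (belowX g r' x2)) r

/-- THE TWO-LEVEL-CHUNKED SEARCH for the size pattern `(2,1,1)^k` over chunks `(d, x1, x2)` (representative `d` of
`A₀ = {0, d}`, first-level exclusion mask `x1`, second-level exclusion mask `x2`): `true` certifies that no normal-form solution
of the difference model with `d` listed, `c₁ ∉ x1` and `c₂ ∉ x2` exists (reflection below). -/
noncomputable def search2 (g : GC) (k : ℕ) (chunks : List (ℕ × ℕ × ℕ)) : Bool :=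
  @List.rec (ℕ × ℕ × ℕ) (fun _ => Bool) true
    (fun e _ ih => start g (Nat.sub k 1) e.1 (belowX2 g (Nat.sub k 1) e.2.1 e.2.2) && ih) chunks

/-- `search2` on a cons (used to split kernel evaluations by chunk). -/
theorem search2_cons (g : GC) (k : ℕ) (e : ℕ × ℕ × ℕ) (R : List (ℕ × ℕ × ℕ)) :
    search2 g k (e :: R) = (start g (k - 1) e.1 (belowX2 g (k - 1) e.2.1 e.2.2) && search2 g k R) := rfl

/-- `search2` is a conjunction over the chunk list. -/
theorem search2_append (g : GC) (k : ℕ) (R₁ R₂ : List (ℕ × ℕ × ℕ)) :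
    search2 g k (R₁ ++ R₂) = (search2 g k R₁ && search2 g k R₂) := by
  induction R₁ with
  | nil => rfl
  | cons e R ih => rw [List.cons_append, search2_cons, search2_cons, ih, Bool.and_assoc]

/-! ## 2. Reflection: the branch of a normal-form solution is never refuted -/

section Main

variable {G : Type} [AddCommGroup G] {E : GEnc G} {K : ℕ} {p q c : Fin K → G}

/-- THE START OF THE SOLUTION'S CHUNK ANSWERS `false` (two restricted levels): normal-form solution with `c₀ = 0`, `p₀ = 0`,
`q₀ = d`, the first-level exclusion `x1` missing the code of `c₁` and the second-level exclusion `x2` missing the code of `c₂`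
(each if it exists). -/
theorem start_false2 (hM : ModelD p q c) (hNF : NF E p q c) (hK : 0 < K) (hc0 : c ⟨0, hK⟩ = 0) (hp0 : p ⟨0, hK⟩ = 0)
    {x1 x2 : ℕ} (hx1 : ∀ h1 : 1 < K, x1.testBit (E.enc (c ⟨1, h1⟩)) = false)
    (hx2 : ∀ h2 : 2 < K, x2.testBit (E.enc (c ⟨2, h2⟩)) = false) :
    start E.g (K - 1) (E.enc (q ⟨0, hK⟩)) (belowX2 E.g (K - 1) x1 x2) = false := by
  unfold start
  have h0 : (0 : ℕ) = E.enc (c ⟨0, hK⟩) := by rw [hc0, E.enc_zero]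
  have h0' : (0 : ℕ) = E.enc (p ⟨0, hK⟩) := by rw [hp0, E.enc_zero]
  conv_lhs => rw [show (child E.g St.empty (K - 1) 0 0 (E.enc (q ⟨0, hK⟩)) 0 0 0 (belowX2 E.g (K - 1) x1 x2)) =
    child E.g St.empty (K - 1) (E.enc (c ⟨0, hK⟩)) (E.enc (p ⟨0, hK⟩)) (E.enc (q ⟨0, hK⟩)) 0 0 0
      (belowX2 E.g (K - 1) x1 x2) by rw [← h0, ← h0']]
  refine child_false hM hNF (m := 0) (r := K - 1) (by omega) ⟨0, hK⟩ rfl (invM_empty E p q c) (MSub_zero E _)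
    (MSub_zero E _) (MSub_zero E _) fun S' hS' hl' => ?_
  -- the continuation `belowX2`: nothing left, or one `x1`-restricted level, then `belowX · x2`
  unfold belowX2
  rcases Nat.eq_zero_or_pos (K - 1) with hK1 | hK1
  · rw [hK1]; rfl
  · obtain ⟨r, hr⟩ : ∃ r, K - 1 = r + 1 := ⟨K - 1 - 1, by omega⟩
    rw [hr]
    show level E.g S' r x1 (belowX E.g r x2) = false
    have h1 : 1 < K := by omega
    refine level_false (m := 1) (r := r) hM hNF (by omega) ⟨1, h1⟩ rfl ⟨0, hK⟩ rfl hS' hl' (hx1 h1)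
      fun S'' hS'' hl'' => ?_
    -- the continuation `belowX · x2`: nothing left, or one `x2`-restricted level, then free (`below`)
    unfold belowX
    rcases Nat.eq_zero_or_pos r with hr0 | hr0
    · rw [hr0]; rfl
    · obtain ⟨r', hr'⟩ : ∃ r', r = r' + 1 := ⟨r - 1, by omega⟩
      rw [hr']
      show level E.g S'' r' x2 (below E.g r') = false
      have h2 : 2 < K := by omega
      exact level_false (m := 2) (r := r') hM hNF (by omega) ⟨2, h2⟩ rfl ⟨1, h1⟩ rfl hS'' hl'' (hx2 h2)
        fun S₃ hS₃ hl₃ => below_false hM hNF r' 3 ⟨2, h2⟩ S₃ (by omega) rfl hS₃ hl₃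

/-- A `true` two-level search refutes every listed chunk. -/
theorem start_of_search2 {g : GC} {k : ℕ} : ∀ {R : List (ℕ × ℕ × ℕ)}, search2 g k R = true → ∀ e ∈ R,
    start g (k - 1) e.1 (belowX2 g (k - 1) e.2.1 e.2.2) = true := by
  intro R
  induction R with
  | nil => intro _ e he; simp at he
  | cons e' R ih =>
      intro h e he
      rw [search2_cons, Bool.and_eq_true] at h
      rcases List.mem_cons.1 he with rfl | he
      · exact h.1
      · exact ih h.2 e he

/-- **REFLECTION, normal-form version (two levels).** If `search2` returns `true` and the chunks of the code `E.enc (q 0)` cover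
every pair of codes, then no NORMAL-FORM solution `(p, q, c)` of the difference model with `c 0 = 0`, `p 0 = 0` exists. -/
theorem not_modelNF_of_search2 (hK : 0 < K) {chunks : List (ℕ × ℕ × ℕ)} (hsearch : search2 E.g K chunks = true)
    (hM : ModelD p q c) (hNF : NF E p q c) (hc0 : c ⟨0, hK⟩ = 0) (hp0 : p ⟨0, hK⟩ = 0)
    (hcov : ∀ y₁, y₁ < E.g.n → ∀ y₂, y₂ < E.g.n →
      ∃ x1 x2, (E.enc (q ⟨0, hK⟩), x1, x2) ∈ chunks ∧ x1.testBit y₁ = false ∧ x2.testBit y₂ = false) : False := by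
  -- the codes to be covered: those of c₁ and c₂ if they exist, else 0
  let y₁ : ℕ := if h1 : 1 < K then E.enc (c ⟨1, h1⟩) else 0
  let y₂ : ℕ := if h2 : 2 < K then E.enc (c ⟨2, h2⟩) else 0
  have hn : 0 < E.g.n := lt_of_le_of_lt (Nat.zero_le _) (E.enc_lt 0)
  have hy₁ : y₁ < E.g.n := by dsimp only [y₁]; split_ifs <;> first | exact E.enc_lt _ | exact hn
  have hy₂ : y₂ < E.g.n := by dsimp only [y₂]; split_ifs <;> first | exact E.enc_lt _ | exact hn
  obtain ⟨x1, x2, hmem, hx1, hx2⟩ := hcov y₁ hy₁ y₂ hy₂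
  have := start_of_search2 hsearch _ hmem
  rw [start_false2 hM hNF hK hc0 hp0 (fun h1 => by simpa [y₁, h1] using hx1)
    (fun h2 => by simpa [y₂, h2] using hx2)] at this
  exact Bool.false_ne_true this

end Main

/-! ## 3. The reflection theorems (two levels) -/

section Reflection

variable {G : Type} [AddCommGroup G] {K : ℕ}

/-- **REFLECTION (difference model, two-level chunks).** If `search2` returns `true` on `chunks`, every PAIR of codes of every
listed representative is covered by a chunk, and every nonzero `d` is moved into the representative list by an injective map
of `auts`, then the `(2,1,1)` difference model has NO solution with `K` triples in `G` (`K ≥ 1`). -/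
theorem not_modelD_of_search2 (E : GEnc G) (hK : 0 < K) {chunks : List (ℕ × ℕ × ℕ)}
    (hsearch : search2 E.g K chunks = true) {dlist : List ℕ}
    (hchunks : ∀ d ∈ dlist, ∀ y₁, y₁ < E.g.n → ∀ y₂, y₂ < E.g.n →
      ∃ e ∈ chunks, e.1 = d ∧ e.2.1.testBit y₁ = false ∧ e.2.2.testBit y₂ = false)
    {auts : List (G →+ G)} (hinj : ∀ f ∈ auts, Function.Injective f)
    (hcover : ∀ d : G, d ≠ 0 → ∃ f ∈ auts, E.enc (f d) ∈ dlist) (p q c : Fin K → G) : ¬ ModelD p q c := by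
  intro hM
  obtain ⟨p', q', c', hM', hNF, hc0, hp0, hd⟩ := exists_normalForm E hM hK hinj hcover
  refine not_modelNF_of_search2 hK hsearch hM' hNF hc0 hp0 fun y₁ hy₁ y₂ hy₂ => ?_
  obtain ⟨e, he, h1, h2, h3⟩ := hchunks _ hd y₁ hy₁ y₂ hy₂
  refine ⟨e.2.1, e.2.2, ?_, h2, h3⟩
  rw [← h1]; exact he

/-- **REFLECTION THROUGH DEF. 5.1 (two-level chunks).** Under the hypotheses of `not_modelD_of_search2`, the group `G` admits
NO STPP family (CKSU Def. 5.1, tree `IsSTPP`) of `K` triples with `|Aᵢ| = 2`, `|Bᵢ| = |Cᵢ| = 1` — by the tree's criterion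
`exists_isSTPP_211_iff` (`STPPSmallPatternCriteria.lean`). [cite: CohnKleinbergSzegedyUmans2005, Def. 5.1] -/
theorem not_exists_isSTPP_211_of_search2 [DecidableEq G] (E : GEnc G) (hK : 0 < K) {chunks : List (ℕ × ℕ × ℕ)}
    (hsearch : search2 E.g K chunks = true) {dlist : List ℕ}
    (hchunks : ∀ d ∈ dlist, ∀ y₁, y₁ < E.g.n → ∀ y₂, y₂ < E.g.n →
      ∃ e ∈ chunks, e.1 = d ∧ e.2.1.testBit y₁ = false ∧ e.2.2.testBit y₂ = false)
    {auts : List (G →+ G)} (hinj : ∀ f ∈ auts, Function.Injective f)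
    (hcover : ∀ d : G, d ≠ 0 → ∃ f ∈ auts, E.enc (f d) ∈ dlist) :
    ¬ ∃ A B C : Fin K → Finset G, IsSTPP A B C ∧
      ∀ i, (A i).card = 2 ∧ (B i).card = 1 ∧ (C i).card = 1 := by
  rw [exists_isSTPP_211_iff]
  rintro ⟨p, q, c, hpq, hD, hX⟩
  exact not_modelD_of_search2 E hK hsearch hchunks hinj hcover p q c (modelD_of_finsetForm hpq hD hX)

end Reflection

end STPP211Neg

end Summit.MatrixMultiplication.OmegaCensus
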